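import Literature.NumberTheory.Transcendental.ManyCurveStd
import Literature.NumberTheory.Transcendental.PkappaThetaPoints
import Literature.NumberTheory.Transcendental.PkappaThetaGrowth
import Literature.NumberTheory.Transcendental.ThetaAnalytic
import Literature.NumberTheory.Transcendental.OrbitCard
import HarnessLib

/-!
# The theta model of the `k`-lattice standard models `M = 𝔾ₘ^β × P`

Topic `Literature/NumberTheory/Transcendental`; unit
`provefact-Literature.NumberTheory.Transcendental.H-0a3eb64689` (fact
`Literature.NumberTheory.Transcendental.HuberWustholzManyCurvePeriods`, `ManyCurvePeriods.lean`).
It introduces NO named fact. Lattice-family counterpart of the two-lattice `TwoCurveTheta.lean`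
(and of the one-lattice files `PkappaTheta.lean`, `PkappaThetaPoints.lean`,
`PkappaThetaGrowth.lean`, `ThetaAnalytic.lean`, the definitions of `PhilipponZeroEstimateStd.lean`
and `OrbitCard.lean`), for the family standard models `M = 𝔾ₘ^β × P` of `ManyCurveStd.lean`
(lattice family `L : 𝓙 → PeriodPair`, class map `cls : γ → 𝓙`; `P` the push-out of the universal
vectorial extension of `∏_b E_{cls b}` along `κ : ℚ̄^γ → ℚ̄^δ`).

The theta functions are the one-lattice ones computed BLOCKWISE with the lattice `Λ_{cls b}` of
the block: `Θ^P_{(M, none)} = ∏_b P^{Λ_{cls b}}_{M b}(z'_b)`,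
`Θ^P_{(M, some e)} = s_e ∏_b P_{M b} - ∑_b κ_{eb} Z^{Λ_{cls b}}_{M b}(z'_b) ∏_{b'≠b} P_{M b'}`, Segre
product with the torus coordinates `GaGmE.Std.thetaT` (reused verbatim, as are `ThetaIdx`,
`VanishesAlong` and all per-lattice facts of `UnivExtTheta*.lean`).

## What is proved here (everything; no `sorry`, no new `def … : Prop`)

* `GaGmEFam.Std.thetaPnone/thetaPsome/thetaP/theta`, `differentiable_theta`, `thetaPnone_eq`,
  `thetaPsome_eq` (values off the divisors), `exists_theta_add_ker` (automorphy under
  `ker(exp_M)`: each block picks up the factor of its own lattice), `exists_theta_ne_zero`;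
* `thetaEval` (`F_P = P(Θ)`), `thetaEval_X/mul`; `SubgroupDataC` (obstruction data over `ℂ`,
  block-diagonal abelian part), `toOne`, `tangent`, `mem_tangent_iff`, `top`, `tangent_top`;
  `preimageSubgroup`, `orbitCard`, `orbitCard_le`, `one_le_orbitCard`, `orbitCard_eq`;
* `thetaPsome_eq_mul_prod`, `exists_isAlgebraic_theta_div`, `exists_theta_div_mem_Kbar`
  (at algebraic points `[Θ(w)]` is `ℚ̄`-rational — each block with the algebraic invariants of its
  own lattice), `exists_norm_theta_le` (order-two growth, with the sum of the blockwise
  constants), `analyticAt_theta`, `analyticAt_thetaEval`, `contDiff_thetaEval`,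
  `differentiable_thetaEval`, `continuous_thetaEval`.

## References

* A. Baker, G. Wüstholz, *Logarithmic Forms and Diophantine Geometry*, CUP 2007, §6.7–6.9.
  [BakerWustholz2007]
* P. Philippon, *Lemmes de zéros dans les groupes algébriques commutatifs*, Bull. SMF 114 (1986),
  §2, Thm. 2.1. [Philippon1986]
* A. Huber, G. Wüstholz, *Transcendence and Linear Relations of 1-Periods*, Cambridge Tracts 227,
  CUP 2022, Thm. 15.3 (1). [HuberWustholz2022]
-/

noncomputable section

open Complex Set
open scoped PeriodPair ContDiff

namespace Literature.NumberTheory.Transcendental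

namespace GaGmEFam

namespace Std

open GaGmE (Kbar)
open GaGmE.Std (iy iz is coords coords_iy coords_iz coords_is sum_blocks ThetaIdx thetaT thetaT_none
  thetaT_some differentiable_thetaT differentiable_finset_prod norm_prod_le_pow analyticAt_coord
  analyticAt_comp_coord analyticAt_thetaT VanishesAlong isAlgebraic_coe_Kbar)

variable {𝓙 : Type} [DecidableEq 𝓙] {β γ δ : Type} [Fintype β] [Fintype γ] [Fintype δ]
variable [DecidableEq γ]
variable (L : 𝓙 → PeriodPair) (cls : γ → 𝓙) (κM : δ → γ → Kbar)

/-! ### The theta functions of the family standard model -/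

/-- The uncorrected products `∏_b P_{M b}(z'_b)`, the block `b` computed with the lattice
`Λ_{cls b}`. [folklore] -/
def thetaPnone (M : γ → Fin 3) (w : β ⊕ (γ ⊕ δ) → ℂ) : ℂ :=
  ∏ b, (L (cls b)).univExtP (M b) (w (iz b))

/-- The fibre sections
`s_e ∏_b P_{M b}(z'_b) - ∑_b κ_{eb} Z_{M b}(z'_b) ∏_{b' ≠ b} P_{M b'}(z'_{b'})`, blockwise lattices.
[folklore] -/
def thetaPsome (M : γ → Fin 3) (e : δ) (w : β ⊕ (γ ⊕ δ) → ℂ) : ℂ :=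
  w (is e) * thetaPnone L cls M w -
    ∑ b, (κM e b : ℂ) * ((L (cls b)).univExtZ (M b) (w (iz b)) *
      ∏ b' ∈ Finset.univ.erase b, (L (cls b')).univExtP (M b') (w (iz b')))

/-- **The theta functions of `P`** (`P` the push-out of the universal vectorial extension of
`∏_b E_{cls b}` along `κ`), a basis of the linear system `|∑_b 3F_{0,b} + D_∞|` of its
compactification, exactly as `GaGmE.Std.thetaP` with blockwise lattices. [folklore] -/
def thetaP : ThetaIdx γ δ → (β ⊕ (γ ⊕ δ) → ℂ) → ℂ
  | (M, none) => thetaPnone L cls M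
  | (M, some e) => thetaPsome L cls κM M e

/-- **The theta functions of `M = 𝔾ₘ^β × P`** (Segre product with the torus coordinates
`GaGmE.Std.thetaT`): entire functions on `Lie M_ℂ` giving the projective coordinates of
`exp_M(w)`. [folklore] -/
def theta (J : Option β × ThetaIdx γ δ) (w : β ⊕ (γ ⊕ δ) → ℂ) : ℂ :=
  thetaT J.1 w * thetaP L cls κM J.2 w

omit [Fintype β] [Fintype δ] in
omit [DecidableEq 𝓙] in
/-- `Θ^P_{(M, none)}`. [folklore] -/
@[simp] theorem thetaP_none (M : γ → Fin 3) :
    thetaP L cls κM (M, none) = thetaPnone (β := β) (δ := δ) L cls M := rfl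

omit [Fintype β] [Fintype δ] in
omit [DecidableEq 𝓙] in
/-- `Θ^P_{(M, some e)}`. [folklore] -/
@[simp] theorem thetaP_some (M : γ → Fin 3) (e : δ) :
    thetaP L cls κM (M, some e) = thetaPsome (β := β) L cls κM M e := rfl

/-! ### Holomorphy -/

omit [DecidableEq γ] in
omit [DecidableEq 𝓙] in
/-- `w ↦ P_i(z'_b(w))` is entire. [folklore] -/
theorem differentiable_univExtP_comp (i : Fin 3) (b : γ) :
    Differentiable ℂ fun w : β ⊕ (γ ⊕ δ) → ℂ => (L (cls b)).univExtP i (w (iz b)) :=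
  ((L (cls b)).differentiable_univExtP i).comp (differentiable_apply (𝕜 := ℂ) (iz b))

omit [DecidableEq γ] in
omit [DecidableEq 𝓙] in
/-- `w ↦ Z_i(z'_b(w))` is entire. [folklore] -/
theorem differentiable_univExtZ_comp (i : Fin 3) (b : γ) :
    Differentiable ℂ fun w : β ⊕ (γ ⊕ δ) → ℂ => (L (cls b)).univExtZ i (w (iz b)) :=
  ((L (cls b)).differentiable_univExtZ i).comp (differentiable_apply (𝕜 := ℂ) (iz b))

omit [DecidableEq 𝓙] in
/-- `Θ^P_{(M, none)}` is entire. [folklore] -/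
theorem differentiable_thetaPnone (M : γ → Fin 3) :
    Differentiable ℂ (thetaPnone (β := β) (δ := δ) L cls M) := by
  unfold thetaPnone
  exact differentiable_finset_prod Finset.univ fun b _ => differentiable_univExtP_comp L cls (M b) b

omit [DecidableEq 𝓙] in
/-- `Θ^P_{(M, some e)}` is entire. [folklore] -/
theorem differentiable_thetaPsome (M : γ → Fin 3) (e : δ) :
    Differentiable ℂ (thetaPsome (β := β) L cls κM M e) := by
  unfold thetaPsome
  refine ((differentiable_apply (𝕜 := ℂ) (is e)).mul (differentiable_thetaPnone L cls M)).sub ?_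
  refine Differentiable.fun_sum fun b _ => (differentiable_const _).mul ?_
  exact (differentiable_univExtZ_comp L cls (M b) b).mul
    (differentiable_finset_prod _ fun b' _ => differentiable_univExtP_comp L cls (M b') b')

omit [DecidableEq 𝓙] in
/-- The theta functions of `P` are entire. [folklore] -/
theorem differentiable_thetaP (I : ThetaIdx γ δ) :
    Differentiable ℂ (thetaP (β := β) L cls κM I) := by
  obtain ⟨M, _ | e⟩ := I
  · exact differentiable_thetaPnone L cls M
  · exact differentiable_thetaPsome L cls κM M e

omit [DecidableEq 𝓙] in
/-- **The theta functions of `M` are entire.** [folklore] -/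
theorem differentiable_theta (J : Option β × ThetaIdx γ δ) :
    Differentiable ℂ (theta L cls κM J) :=
  (differentiable_thetaT J.1).mul (differentiable_thetaP L cls κM J.2)

/-! ### Values off the divisors -/

omit [Fintype β] [Fintype δ] [DecidableEq γ] in
omit [DecidableEq 𝓙] in
/-- Off the divisors `z'_b ∈ Λ_b`: `Θ^P_{(M, none)}(w) = ∏_b σ_b(z'_b)³ · ∏_b A_{M b}(z'_b)`,
`A = (1, ℘_b, ℘′_b)` with the Weierstrass functions of `Λ_b`. [folklore] -/
theorem thetaPnone_eq (M : γ → Fin 3) {w : β ⊕ (γ ⊕ δ) → ℂ}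
    (hw : ∀ b, w (iz b) ∉ (L (cls b)).lattice) :
    thetaPnone (δ := δ) L cls M w = (∏ b, (L (cls b)).weierstrassSigma (w (iz b)) ^ 3) *
      ∏ b, ![1, ℘[L (cls b)] (w (iz b)), ℘'[L (cls b)] (w (iz b))] (M b) := by
  unfold thetaPnone
  rw [← Finset.prod_mul_distrib]
  refine Finset.prod_congr rfl fun b _ => ?_
  obtain ⟨p0, p1, p2⟩ := PeriodPair.univExtP_eq (hw b)
  have : ∀ i : Fin 3, (L (cls b)).univExtP i (w (iz b)) =
      (L (cls b)).weierstrassSigma (w (iz b)) ^ 3 *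
        ![1, ℘[L (cls b)] (w (iz b)), ℘'[L (cls b)] (w (iz b))] i := by
    intro i; fin_cases i
    · simpa using p0
    · simpa using p1
    · simpa using p2
  exact this (M b)

omit [Fintype β] [Fintype δ] in
omit [DecidableEq 𝓙] in
/-- Off the divisors: `Θ^P_{(M, some e)}` through the companions `Z = σ³(ζ, ℘ζ, ℘′ζ + 2℘²)`,
blockwise. [folklore] -/
theorem thetaPsome_eq (M : γ → Fin 3) (e : δ) {w : β ⊕ (γ ⊕ δ) → ℂ}
    (hw : ∀ b, w (iz b) ∉ (L (cls b)).lattice) :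
    thetaPsome L cls κM M e w = (∏ b, (L (cls b)).weierstrassSigma (w (iz b)) ^ 3) *
      (w (is e) * ∏ b, ![1, ℘[L (cls b)] (w (iz b)), ℘'[L (cls b)] (w (iz b))] (M b) -
        ∑ b, (κM e b : ℂ) *
          (![(L (cls b)).weierstrassZeta (w (iz b)),
              ℘[L (cls b)] (w (iz b)) * (L (cls b)).weierstrassZeta (w (iz b)),
              ℘'[L (cls b)] (w (iz b)) * (L (cls b)).weierstrassZeta (w (iz b)) +
                2 * ℘[L (cls b)] (w (iz b)) ^ 2] (M b) *
            ∏ b' ∈ Finset.univ.erase b,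
              ![1, ℘[L (cls b')] (w (iz b')), ℘'[L (cls b')] (w (iz b'))] (M b'))) := by
  have hA : ∀ b (i : Fin 3), (L (cls b)).univExtP i (w (iz b)) =
      (L (cls b)).weierstrassSigma (w (iz b)) ^ 3 *
        ![1, ℘[L (cls b)] (w (iz b)), ℘'[L (cls b)] (w (iz b))] i := by
    intro b i
    obtain ⟨p0, p1, p2⟩ := PeriodPair.univExtP_eq (hw b)
    fin_cases i
    · simpa using p0
    · simpa using p1
    · simpa using p2
  have hB : ∀ b (i : Fin 3), (L (cls b)).univExtZ i (w (iz b)) =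
      (L (cls b)).weierstrassSigma (w (iz b)) ^ 3 *
        ![(L (cls b)).weierstrassZeta (w (iz b)),
          ℘[L (cls b)] (w (iz b)) * (L (cls b)).weierstrassZeta (w (iz b)),
          ℘'[L (cls b)] (w (iz b)) * (L (cls b)).weierstrassZeta (w (iz b)) +
            2 * ℘[L (cls b)] (w (iz b)) ^ 2] i := by
    intro b i
    obtain ⟨z0, z1, z2⟩ := PeriodPair.univExtZ_eq (hw b)
    fin_cases i
    · simpa using z0
    · simpa using z1
    · simpa using z2
  unfold thetaPsome
  rw [thetaPnone_eq L cls M hw, mul_sub, Finset.mul_sum]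
  congr 1
  · ring
  · refine Finset.sum_congr rfl fun b _ => ?_
    rw [hB b (M b)]
    have hprod : ∏ b' ∈ Finset.univ.erase b, (L (cls b')).univExtP (M b') (w (iz b')) =
        (∏ b' ∈ Finset.univ.erase b, (L (cls b')).weierstrassSigma (w (iz b')) ^ 3) *
          ∏ b' ∈ Finset.univ.erase b,
            ![1, ℘[L (cls b')] (w (iz b')), ℘'[L (cls b')] (w (iz b'))] (M b') := by
      rw [← Finset.prod_mul_distrib]
      exact Finset.prod_congr rfl fun b' _ => hA b' (M b')
    rw [hprod, ← Finset.mul_prod_erase Finset.univ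
      (fun b' => (L (cls b')).weierstrassSigma (w (iz b')) ^ 3) (Finset.mem_univ b)]
    ring

/-! ### Automorphy under the kernel of `exp_M` -/

omit [Fintype β] [Fintype δ] in
omit [DecidableEq 𝓙] in
/-- **Automorphy under `ker(exp_M)`.** For `k ∈ ker` and every `w` there is `c ≠ 0` with
`Θ_J(w + k) = c · Θ_J(w)` for ALL `J` (each block picks up the factor of its own lattice; the
shifts of the `ζ`-companions cancel against the `s`-shift of the kernel vector). [folklore] -/
theorem exists_theta_add_ker (w : β ⊕ (γ ⊕ δ) → ℂ) {k : β ⊕ (γ ⊕ δ) → ℂ}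
    (hk : k ∈ ker L cls κM) :
    ∃ c : ℂ, c ≠ 0 ∧ ∀ J, theta L cls κM J (w + k) = c * theta L cls κM J w := by
  obtain ⟨hy, m, n, hz, hs⟩ := hk
  have hb : ∀ b, ∃ c : ℂ, c ≠ 0 ∧
      (∀ i, (L (cls b)).univExtP i (w (iz b) + k (iz b)) = c * (L (cls b)).univExtP i (w (iz b))) ∧
      (∀ i, (L (cls b)).univExtZ i (w (iz b) + k (iz b)) =
        c * ((L (cls b)).univExtZ i (w (iz b)) +
          (m b * (L (cls b)).η₁ + n b * (L (cls b)).η₂) * (L (cls b)).univExtP i (w (iz b)))) := by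
    intro b
    obtain ⟨c, hc, h⟩ := (L (cls b)).exists_univExtTheta_add_lattice (m b) (n b) (w (iz b)) 0
    refine ⟨c, hc, fun i => ?_, fun i => ?_⟩
    · have := h (Sum.inl i)
      simpa [hz b] using this
    · have hP := h (Sum.inl i)
      have hZ := h (Sum.inr i)
      simp only [PeriodPair.univExtTheta_inl, PeriodPair.univExtTheta_inr, zero_add, zero_mul,
        zero_sub, mul_neg] at hP hZ
      rw [hz b]
      linear_combination -hZ + (m b * (L (cls b)).η₁ + n b * (L (cls b)).η₂) * hP
  choose c hc hP hZ using hb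
  refine ⟨∏ b, c b, Finset.prod_ne_zero_iff.mpr fun b _ => hc b, ?_⟩
  have hT : ∀ a, thetaT (γ := γ) (δ := δ) a (w + k) = thetaT a w := by
    rintro (_ | j)
    · rfl
    · obtain ⟨p, hp⟩ := hy j
      simp only [thetaT_some, Pi.add_apply, hp, Complex.exp_add, Complex.exp_int_mul_two_pi_mul_I,
        mul_one]
  have hnone : ∀ M : γ → Fin 3, thetaPnone (β := β) (δ := δ) L cls M (w + k) =
      (∏ b, c b) * thetaPnone L cls M w := by
    intro M
    unfold thetaPnone
    rw [← Finset.prod_mul_distrib]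
    exact Finset.prod_congr rfl fun b _ => hP b (M b)
  have hsome : ∀ (M : γ → Fin 3) (e : δ), thetaPsome (β := β) L cls κM M e (w + k) =
      (∏ b, c b) * thetaPsome L cls κM M e w := by
    intro M e
    have herase : ∀ b, ∏ b' ∈ Finset.univ.erase b, (L (cls b')).univExtP (M b') ((w + k) (iz b')) =
        (∏ b' ∈ Finset.univ.erase b, c b') *
          ∏ b' ∈ Finset.univ.erase b, (L (cls b')).univExtP (M b') (w (iz b')) := fun b => by
      rw [← Finset.prod_mul_distrib]
      exact Finset.prod_congr rfl fun b' _ => hP b' (M b')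
    have hce : ∀ b, c b * ∏ b' ∈ Finset.univ.erase b, c b' = ∏ b', c b' := fun b =>
      Finset.mul_prod_erase Finset.univ c (Finset.mem_univ b)
    have hPe : ∀ b, (L (cls b)).univExtP (M b) (w (iz b)) *
        ∏ b' ∈ Finset.univ.erase b, (L (cls b')).univExtP (M b') (w (iz b')) =
        thetaPnone (β := β) (δ := δ) L cls M w :=
      fun b => Finset.mul_prod_erase Finset.univ
        (fun b' => (L (cls b')).univExtP (M b') (w (iz b'))) (Finset.mem_univ b)
    unfold thetaPsome
    rw [hnone M]
    simp only [Pi.add_apply] at herase ⊢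
    simp only [herase, hZ, hs e]
    have key : ∀ b, (κM e b : ℂ) * (c b * ((L (cls b)).univExtZ (M b) (w (iz b)) +
        (m b * (L (cls b)).η₁ + n b * (L (cls b)).η₂) * (L (cls b)).univExtP (M b) (w (iz b))) *
        ((∏ b' ∈ Finset.univ.erase b, c b') *
          ∏ b' ∈ Finset.univ.erase b, (L (cls b')).univExtP (M b') (w (iz b')))) =
        (∏ b', c b') * ((κM e b : ℂ) * ((L (cls b)).univExtZ (M b) (w (iz b)) *
          ∏ b' ∈ Finset.univ.erase b, (L (cls b')).univExtP (M b') (w (iz b')))) +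
        (∏ b', c b') * ((κM e b : ℂ) * (m b * (L (cls b)).η₁ + n b * (L (cls b)).η₂)) *
          thetaPnone L cls M w := by
      intro b
      rw [← hce b, ← hPe b]
      ring
    rw [Finset.sum_congr rfl fun b _ => key b, Finset.sum_add_distrib, ← Finset.mul_sum,
      ← Finset.sum_mul, ← Finset.mul_sum]
    unfold thetaPnone
    ring
  intro J
  obtain ⟨a, M, _ | e⟩ := J
  · simp only [theta, thetaP_none, hT, hnone]; ring
  · simp only [theta, thetaP_some, hT, hsome]; ring

/-! ### No common zeros -/

omit [Fintype β] [Fintype δ] in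
omit [DecidableEq 𝓙] in
/-- **The theta functions of `M` have no common zero.** [folklore] -/
theorem exists_theta_ne_zero (w : β ⊕ (γ ⊕ δ) → ℂ) : ∃ J, theta L cls κM J w ≠ 0 := by
  classical
  let M : γ → Fin 3 := fun b => if w (iz b) ∈ (L (cls b)).lattice then 2 else 0
  have hM : ∀ b, (L (cls b)).univExtP (M b) (w (iz b)) ≠ 0 := by
    intro b
    by_cases hb : w (iz b) ∈ (L (cls b)).lattice
    · obtain ⟨m', n', hmn⟩ := PeriodPair.mem_lattice.mp hb
      obtain ⟨c, hc, -, -, h2, -⟩ := (L (cls b)).exists_univExtTheta_lattice m' n' 0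
      simp only [PeriodPair.univExtTheta_inl] at h2
      have : M b = 2 := if_pos hb
      rw [this, ← hmn, h2]
      exact mul_ne_zero hc (by norm_num)
    · have : M b = 0 := if_neg hb
      rw [this, (PeriodPair.univExtP_eq hb).1]
      exact pow_ne_zero _ ((L (cls b)).weierstrassSigma_ne_zero hb)
  refine ⟨(none, (M, none)), ?_⟩
  simp only [theta, thetaT_none, thetaP_none, one_mul, thetaPnone]
  exact Finset.prod_ne_zero_iff.mpr fun b _ => hM b

/-! ### Forms in the theta functions, obstruction data over `ℂ`, the orbit count -/

/-- **The entire function `F_P = P(Θ)` on `Lie M_ℂ`** attached to a polynomial in the projective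
coordinates `X_J ↔ Θ_J` of `M` (as `GaGmE.Std.thetaEval`). [cite: Philippon1986, §2 (R, 𝒵(P))] -/
def thetaEval (P : MvPolynomial (Option β × ThetaIdx γ δ) ℂ) (w : β ⊕ (γ ⊕ δ) → ℂ) : ℂ :=
  MvPolynomial.eval (fun J => theta L cls κM J w) P

omit [Fintype β] [Fintype δ] in
omit [DecidableEq 𝓙] in
/-- `F_{X_J} = Θ_J`. [folklore] -/
@[simp] theorem thetaEval_X (J : Option β × ThetaIdx γ δ) (w : β ⊕ (γ ⊕ δ) → ℂ) :
    thetaEval L cls κM (MvPolynomial.X J) w = theta L cls κM J w := by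
  simp [thetaEval]

omit [Fintype β] [Fintype δ] in
omit [DecidableEq 𝓙] in
/-- `F_{PQ} = F_P F_Q`. [folklore] -/
theorem thetaEval_mul (P Q : MvPolynomial (Option β × ThetaIdx γ δ) ℂ)
    (w : β ⊕ (γ ⊕ δ) → ℂ) :
    thetaEval L cls κM (P * Q) w = thetaEval L cls κM P w * thetaEval L cls κM Q w := by
  simp [thetaEval]

/-- **Connected algebraic subgroups of `M_ℂ`** in the dual form of `SubgroupData` but over the
algebraically closed field `K = ℂ` of Philippon's theorem: `A ≤ ℚ^β`, a BLOCK-DIAGONAL `C ≤ ℚ^γ`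
(rigid data: subtori, and abelian subvarieties of `∏_b E_{cls b}`, which are products of abelian
subvarieties of the isotypic factors `E_i^{cls⁻¹(i)}` since `Hom(E_i, E_j) = 0` for `i ≠ j`), and a
`ℂ`-subspace `Ξ ≤ ℂ^δ` with the compatibility `ξ ∘ κ ∈ span_ℂ C` (as `GaGmE.Std.SubgroupDataC`).
[folklore] -/
structure SubgroupDataC {𝓙 : Type} [DecidableEq 𝓙] (β γ δ : Type) [Fintype β] [Fintype γ]
    [Fintype δ] (cls : γ → 𝓙) (κM : δ → γ → Kbar) where
  /-- Rational characters of `𝔾ₘ^β` killing `Lie G'`. -/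
  A : Submodule ℚ (β → ℚ)
  /-- Rational homomorphisms `∏_b E_{cls b} → E_i` killing the abelian part of `G'`. -/
  C : Submodule ℚ (γ → ℚ)
  /-- `C` is block-diagonal along the classes. -/
  blockDiag : IsBlockDiag cls C
  /-- Complex additive characters of `𝔾ₐ^δ` killing the vector part of `G'`. -/
  Ξ : Submodule ℂ (δ → ℂ)
  /-- Compatibility: `ξ ∘ κ ∈ span_ℂ C` for `ξ ∈ Ξ`. -/
  compat : ∀ ξ ∈ Ξ, (fun b => ∑ e, ξ e * (κM e b : ℂ)) ∈
    Submodule.span ℂ ((fun c : γ → ℚ => fun b => (c b : ℂ)) '' (C : Set (γ → ℚ)))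

namespace SubgroupDataC

variable {L cls κM}

/-- The same data as one-lattice-shaped `ℂ`-data on the block index `γ`. [folklore] -/
def toOne (K : SubgroupDataC β γ δ cls κM) : GaGmE.Std.SubgroupDataC β γ δ κM where
  A := K.A
  C := K.C
  Ξ := K.Ξ
  compat := K.compat

/-- **The Lie algebra `Lie G'_ℂ ⊆ Lie M_ℂ`** of the datum `(A, C, Ξ)`. [folklore] -/
def tangent (K : SubgroupDataC β γ δ cls κM) : Submodule ℂ (β ⊕ (γ ⊕ δ) → ℂ) :=
  K.toOne.tangent

omit [DecidableEq γ] in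
/-- Membership in `Lie G'`. [folklore] -/
theorem mem_tangent_iff (K : SubgroupDataC β γ δ cls κM) (w : β ⊕ (γ ⊕ δ) → ℂ) :
    w ∈ K.tangent ↔ (∀ q ∈ K.A, ∑ j, (q j : ℂ) * w (iy j) = 0) ∧
      (∀ c ∈ K.C, ∑ b, (c b : ℂ) * w (iz b) = 0) ∧
        ∀ ξ ∈ K.Ξ, ∑ e, ξ e * w (is e) = 0 :=
  Iff.rfl

variable (cls κM) in
/-- The whole group `M` (`A = 0`, `C = 0`, `Ξ = 0`). [folklore] -/
def top : SubgroupDataC β γ δ cls κM where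
  A := ⊥
  C := ⊥
  blockDiag := isBlockDiag_bot cls
  Ξ := ⊥
  compat := by
    intro ξ hξ
    rw [Submodule.mem_bot] at hξ
    subst hξ
    have : (fun b => ∑ e, (0 : δ → ℂ) e * (κM e b : ℂ)) = 0 := by funext b; simp
    rw [this]
    exact Submodule.zero_mem _

omit [DecidableEq γ] in
/-- `Lie M = ⊤`. [folklore] -/
theorem tangent_top : (top cls κM : SubgroupDataC β γ δ cls κM).tangent = ⊤ := by
  rw [eq_top_iff]
  rintro w -
  refine ⟨fun q hq => ?_, fun c hc => ?_, fun ξ hξ => ?_⟩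
  · change q ∈ (⊥ : Submodule ℚ (β → ℚ)) at hq
    rw [Submodule.mem_bot] at hq; subst hq; simp
  · change c ∈ (⊥ : Submodule ℚ (γ → ℚ)) at hc
    rw [Submodule.mem_bot] at hc; subst hc; simp
  · change ξ ∈ (⊥ : Submodule ℂ (δ → ℂ)) at hξ
    rw [Submodule.mem_bot] at hξ; subst hξ; simp

end SubgroupDataC

/-- `exp⁻¹(G')` for the connected algebraic subgroup `G' = exp(Lie G')`: the subgroup
`Lie G' + ker(exp_M)` of `Lie M_ℂ`. [folklore] -/
def preimageSubgroup (K : SubgroupDataC β γ δ cls κM) : AddSubgroup (β ⊕ (γ ⊕ δ) → ℂ) :=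
  K.tangent.toAddSubgroup ⊔ AddSubgroup.closure (ker L cls κM)

/-- **`card((Σ + G')/G')` for `Σ = {0, g, …, Sg}`, `g = exp v`**: the number of classes of
`0, v, 2v, …, Sv` modulo `exp⁻¹(G') = Lie G' + ker`. [cite: Philippon1986, Thm 2.1 (card((Σ+G')/G'))] -/
def orbitCard (K : SubgroupDataC β γ δ cls κM) (v : β ⊕ (γ ⊕ δ) → ℂ) (S : ℕ) : ℕ :=
  Set.ncard (Set.range fun s : Fin (S + 1) =>
    (QuotientAddGroup.mk ((s : ℂ) • v) : (β ⊕ (γ ⊕ δ) → ℂ) ⧸ preimageSubgroup L cls κM K))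

omit [DecidableEq γ] in
/-- `orbitCard ≤ S + 1`. [folklore] -/
theorem orbitCard_le (K : SubgroupDataC β γ δ cls κM) (v : β ⊕ (γ ⊕ δ) → ℂ) (S : ℕ) :
    orbitCard L cls κM K v S ≤ S + 1 := by
  unfold orbitCard
  rw [← Set.image_univ]
  refine (Set.ncard_image_le (Set.finite_univ)).trans ?_
  rw [Set.ncard_univ, Nat.card_eq_fintype_card, Fintype.card_fin]

omit [DecidableEq γ] in
/-- `1 ≤ orbitCard`. [folklore] -/
theorem one_le_orbitCard (K : SubgroupDataC β γ δ cls κM) (v : β ⊕ (γ ⊕ δ) → ℂ) (S : ℕ) :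
    1 ≤ orbitCard L cls κM K v S := by
  unfold orbitCard
  rw [Nat.one_le_iff_ne_zero, Ne, Set.ncard_eq_zero (Set.finite_range _)]
  exact Set.range_nonempty _ |>.ne_empty

omit [DecidableEq γ] in
/-- **The orbit count without small multiples in `exp⁻¹(G')`**: if `r·v ∉ Lie G'_ℂ + ker` for
all `0 < r ≤ S` then `card((Σ + G')/G') = S + 1`. [cite: Philippon1986, Thm 2.1 (card((Σ+G')/G'))] -/
theorem orbitCard_eq (K : SubgroupDataC β γ δ cls κM) (v : β ⊕ (γ ⊕ δ) → ℂ) (S : ℕ)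
    (h : ∀ r : ℕ, 0 < r → r ≤ S → (r : ℂ) • v ∉ preimageSubgroup L cls κM K) :
    orbitCard L cls κM K v S = S + 1 := by
  unfold orbitCard
  have e : (fun s : Fin (S + 1) =>
      (QuotientAddGroup.mk ((s : ℂ) • v) : (β ⊕ (γ ⊕ δ) → ℂ) ⧸ preimageSubgroup L cls κM K)) =
      fun s : Fin (S + 1) => (s : ℕ) •
        (QuotientAddGroup.mk v : (β ⊕ (γ ⊕ δ) → ℂ) ⧸ preimageSubgroup L cls κM K) := by
    funext s
    rw [← QuotientAddGroup.mk_nsmul, ← Nat.cast_smul_eq_nsmul ℂ]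
  rw [e]
  refine ncard_range_nsmul_eq _ S fun r hr hrS hzero => h r hr hrS ?_
  rw [← QuotientAddGroup.mk_nsmul, ← Nat.cast_smul_eq_nsmul ℂ, QuotientAddGroup.eq_zero_iff] at hzero
  exact hzero


/-! ### Algebraic points have `ℚ̄`-rational projective coordinates -/

omit [Fintype β] [Fintype δ] in
omit [DecidableEq 𝓙] in
/-- **Factorisation of the fibre sections through blockwise ratios** (as
`GaGmE.Std.thetaPsome_eq_mul_prod`). [folklore] -/
theorem thetaPsome_eq_mul_prod (M : γ → Fin 3) (e : δ) (w : β ⊕ (γ ⊕ δ) → ℂ)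
    (d r q t' : γ → ℂ) (hP : ∀ b, (L (cls b)).univExtP (M b) (w (iz b)) = r b * d b)
    (hZ : ∀ b, (L (cls b)).univExtZ (M b) (w (iz b)) = (t' b * r b - q b) * d b) :
    thetaPsome L cls κM M e w =
      ((w (is e) - ∑ b, (κM e b : ℂ) * t' b) * ∏ b, r b +
        ∑ b, (κM e b : ℂ) * (q b * ∏ b' ∈ Finset.univ.erase b, r b')) * ∏ b, d b := by
  have hnone : thetaPnone (β := β) (δ := δ) L cls M w = (∏ b, r b) * ∏ b, d b := by
    unfold thetaPnone
    rw [← Finset.prod_mul_distrib]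
    exact Finset.prod_congr rfl fun b _ => hP b
  have herase : ∀ b, ∏ b' ∈ Finset.univ.erase b, (L (cls b')).univExtP (M b') (w (iz b')) =
      (∏ b' ∈ Finset.univ.erase b, r b') * ∏ b' ∈ Finset.univ.erase b, d b' := fun b => by
    rw [← Finset.prod_mul_distrib]
    exact Finset.prod_congr rfl fun b' _ => hP b'
  have key : ∀ b, (κM e b : ℂ) * ((L (cls b)).univExtZ (M b) (w (iz b)) *
      ∏ b' ∈ Finset.univ.erase b, (L (cls b')).univExtP (M b') (w (iz b'))) =
      (∏ b, d b) * (∏ b, r b) * ((κM e b : ℂ) * t' b) -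
        (∏ b, d b) * ((κM e b : ℂ) * (q b * ∏ b' ∈ Finset.univ.erase b, r b')) := by
    intro b
    rw [hZ b, herase b, ← Finset.mul_prod_erase Finset.univ d (Finset.mem_univ b),
      ← Finset.mul_prod_erase Finset.univ r (Finset.mem_univ b)]
    ring
  unfold thetaPsome
  rw [hnone, Finset.sum_congr rfl fun b _ => key b, Finset.sum_sub_distrib, ← Finset.mul_sum,
    ← Finset.mul_sum]
  ring

omit [Fintype β] [Fintype δ] in
omit [DecidableEq 𝓙] in
/-- **At algebraic points of `M` the projective point `[Θ(w)]` is `ℚ̄`-rational** (as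
`GaGmE.Std.exists_isAlgebraic_theta_div`, each block with the algebraic invariants of its own
lattice). [cite: BakerWustholz2007, §6.8 (p. 119: `f_i(sv) = ϱ X_i(sγ)`)] -/
theorem exists_isAlgebraic_theta_div {L : 𝓙 → PeriodPair} {cls : γ → 𝓙} (hL : ∀ i, IsAlgebraic ℚ (L i).g₂ ∧ IsAlgebraic ℚ (L i).g₃)
    (κM : δ → γ → Kbar) {w : β ⊕ (γ ⊕ δ) → ℂ} (hw : w ∈ Alg L cls κM) :
    ∃ i₀ : γ → Fin 3, thetaPnone (β := β) (δ := δ) L cls i₀ w ≠ 0 ∧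
      ∀ J, IsAlgebraic ℚ (theta L cls κM J w / thetaPnone L cls i₀ w) := by
  obtain ⟨hy, t', hzt, hs⟩ := hw
  have hb : ∀ b, ∃ i₀ : Fin 3, (L (cls b)).univExtP i₀ (w (iz b)) ≠ 0 ∧
      ∀ I, IsAlgebraic ℚ ((L (cls b)).univExtTheta I (w (iz b), t' b) /
        (L (cls b)).univExtP i₀ (w (iz b))) :=
    fun b => (hzt b).exists_isAlgebraic_univExtTheta_div ((hL (cls b)).1)
      ((hL (cls b)).2)
  choose i₀ hi₀ halg using hb
  set d : γ → ℂ := fun b => (L (cls b)).univExtP (i₀ b) (w (iz b)) with hd_def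
  have hd : ∀ b, d b ≠ 0 := hi₀
  have hD : thetaPnone (β := β) (δ := δ) L cls i₀ w = ∏ b, d b := rfl
  have hD0 : ∏ b, d b ≠ 0 := Finset.prod_ne_zero_iff.mpr fun b _ => hd b
  refine ⟨i₀, by rwa [hD], ?_⟩
  set r : (γ → Fin 3) → γ → ℂ := fun M b => (L (cls b)).univExtP (M b) (w (iz b)) / d b
    with hr_def
  set q : (γ → Fin 3) → γ → ℂ := fun M b =>
    (L (cls b)).univExtTheta (Sum.inr (M b)) (w (iz b), t' b) / d b with hq_def
  have hr : ∀ M b, IsAlgebraic ℚ (r M b) := fun M b => by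
    have := halg b (Sum.inl (M b))
    simpa only [PeriodPair.univExtTheta_inl] using this
  have hq : ∀ M b, IsAlgebraic ℚ (q M b) := fun M b => halg b (Sum.inr (M b))
  have hPr : ∀ M b, (L (cls b)).univExtP (M b) (w (iz b)) = r M b * d b := fun M b => by
    simp only [hr_def, div_mul_cancel₀ _ (hd b)]
  have hZq : ∀ M b, (L (cls b)).univExtZ (M b) (w (iz b)) = (t' b * r M b - q M b) * d b :=
      fun M b => by
    have e : (L (cls b)).univExtTheta (Sum.inr (M b)) (w (iz b), t' b) =
        t' b * (L (cls b)).univExtP (M b) (w (iz b)) - (L (cls b)).univExtZ (M b) (w (iz b)) := rfl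
    have hΘ : (L (cls b)).univExtTheta (Sum.inr (M b)) (w (iz b), t' b) = q M b * d b := by
      simp only [hq_def, div_mul_cancel₀ _ (hd b)]
    linear_combination e + t' b * hPr M b - hΘ
  have memK : ∀ {x : ℂ}, IsAlgebraic ℚ x → x ∈ algebraicClosure ℚ ℂ := fun hx =>
    mem_algebraicClosure_iff.mpr hx
  have algK : ∀ {x : ℂ}, x ∈ algebraicClosure ℚ ℂ → IsAlgebraic ℚ x := fun hx =>
    mem_algebraicClosure_iff.mp hx
  have hT : ∀ a, thetaT (γ := γ) (δ := δ) a w ∈ algebraicClosure ℚ ℂ := by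
    rintro (_ | j)
    · exact one_mem _
    · exact memK (hy j)
  have hR : ∀ M, (∏ b, r M b) ∈ algebraicClosure ℚ ℂ := fun M =>
    prod_mem fun b _ => memK (hr M b)
  intro J
  obtain ⟨a, M, _ | e⟩ := J
  · have e1 : theta L cls κM (a, (M, none)) w / thetaPnone L cls i₀ w = thetaT a w * ∏ b, r M b := by
      have hn : thetaPnone (β := β) (δ := δ) L cls M w = (∏ b, r M b) * ∏ b, d b := by
        unfold thetaPnone
        rw [← Finset.prod_mul_distrib]
        exact Finset.prod_congr rfl fun b _ => hPr M b
      simp only [theta, thetaP_none, hn, hD]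
      field_simp
    rw [e1]
    exact algK (mul_mem (hT a) (hR M))
  · have hX : ((w (is e) - ∑ b, (κM e b : ℂ) * t' b) * ∏ b, r M b +
        ∑ b, (κM e b : ℂ) * (q M b * ∏ b' ∈ Finset.univ.erase b, r M b')) ∈
        algebraicClosure ℚ ℂ := by
      refine add_mem (mul_mem (memK (hs e)) (hR M)) (sum_mem fun b _ => ?_)
      exact mul_mem (isAlgebraic_coe_Kbar (κM e b) |> memK)
        (mul_mem (memK (hq M b)) (prod_mem fun b' _ => memK (hr M b')))
    have e1 : theta L cls κM (a, (M, some e)) w / thetaPnone L cls i₀ w =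
        thetaT a w * ((w (is e) - ∑ b, (κM e b : ℂ) * t' b) * ∏ b, r M b +
          ∑ b, (κM e b : ℂ) * (q M b * ∏ b' ∈ Finset.univ.erase b, r M b')) := by
      simp only [theta, thetaP_some, thetaPsome_eq_mul_prod L cls κM M e w d (r M) (q M) t'
        (hPr M) (hZq M), hD]
      field_simp
    rw [e1]
    exact algK (mul_mem (hT a) hX)

omit [Fintype β] [Fintype δ] in
omit [DecidableEq 𝓙] in
/-- In particular `[Θ(w)]` has a representative with ALL coordinates algebraic. [folklore] -/
theorem exists_theta_div_mem_Kbar {L : 𝓙 → PeriodPair} {cls : γ → 𝓙} (hL : ∀ i, IsAlgebraic ℚ (L i).g₂ ∧ IsAlgebraic ℚ (L i).g₃)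
    (κM : δ → γ → Kbar) {w : β ⊕ (γ ⊕ δ) → ℂ} (hw : w ∈ Alg L cls κM) :
    ∃ J₀, theta L cls κM J₀ w ≠ 0 ∧
      ∀ J, theta L cls κM J w / theta L cls κM J₀ w ∈ algebraicClosure ℚ ℂ := by
  obtain ⟨i₀, hi₀, h⟩ := exists_isAlgebraic_theta_div (β := β) hL κM hw
  refine ⟨(none, (i₀, none)), by simpa [theta] using hi₀, fun J => ?_⟩
  have : theta L cls κM (none, (i₀, none)) w = thetaPnone L cls i₀ w := by simp [theta]
  rw [this]
  exact mem_algebraicClosure_iff.mpr (h J)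

/-! ### Growth of order two -/

omit [DecidableEq 𝓙] in
/-- **Order-two growth of the theta functions of `M`.** There is `C ≥ 0` with
`‖Θ_J(w)‖ ≤ e^{C(1 + ‖w‖²)}` for all `J` and `w ∈ Lie M_ℂ` (sup norm) — the blockwise bound with
the sum of the constants of the lattices of the blocks. [cite: BakerWustholz2007, §6.8 (p. 116: log |f_i(z)| ≤ c₁ + c₂‖z‖²)] -/
theorem exists_norm_theta_le :
    ∃ C : ℝ, 0 ≤ C ∧ ∀ (J : Option β × ThetaIdx γ δ) (w : β ⊕ (γ ⊕ δ) → ℂ),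
      ‖theta L cls κM J w‖ ≤ Real.exp (C * (1 + ‖w‖ ^ 2)) := by
  have hbs := fun b : γ => (L (cls b)).exists_norm_univExtP_univExtZ_le
  choose Cb hCb hPZb using hbs
  set C₀ : ℝ := ∑ b, Cb b with hC₀def
  have hC₀ : 0 ≤ C₀ := Finset.sum_nonneg fun b _ => hCb b
  have hPZ : ∀ (b : γ) (i : Fin 3) (z : ℂ),
      ‖(L (cls b)).univExtP i z‖ ≤ Real.exp (C₀ * (1 + ‖z‖ ^ 2)) ∧
        ‖(L (cls b)).univExtZ i z‖ ≤ Real.exp (C₀ * (1 + ‖z‖ ^ 2)) := by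
    intro b i z
    have hle : Cb b ≤ C₀ :=
      Finset.single_le_sum (f := Cb) (fun b _ => hCb b) (Finset.mem_univ b)
    have h1 : Real.exp (Cb b * (1 + ‖z‖ ^ 2)) ≤ Real.exp (C₀ * (1 + ‖z‖ ^ 2)) :=
      Real.exp_le_exp.mpr (mul_le_mul_of_nonneg_right hle (by positivity))
    exact ⟨((hPZb b i z).1).trans h1, ((hPZb b i z).2).trans h1⟩
  set K : ℝ := ∑ e, ∑ b, ‖(κM e b : ℂ)‖ with hK
  have hK0 : 0 ≤ K := Finset.sum_nonneg fun e _ => Finset.sum_nonneg fun b _ => norm_nonneg _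
  set n : ℕ := Fintype.card γ with hn
  refine ⟨C₀ * (n + 1) + K + 3, by positivity, fun J w => ?_⟩
  set R : ℝ := ‖w‖ with hR
  have hR0 : 0 ≤ R := norm_nonneg _
  have hcoord : ∀ i, ‖w i‖ ≤ R := fun i => norm_le_pi_norm w i
  set E : ℝ := Real.exp (C₀ * (1 + R ^ 2)) with hE
  have hE1 : 1 ≤ E := Real.one_le_exp (by positivity)
  have hE0 : 0 ≤ E := zero_le_one.trans hE1
  have hmonoC : ∀ b, Real.exp (C₀ * (1 + ‖w (iz b)‖ ^ 2)) ≤ E := fun b =>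
    Real.exp_le_exp.mpr (by
      have := hcoord (iz b)
      have h2 : ‖w (iz b)‖ ^ 2 ≤ R ^ 2 := pow_le_pow_left₀ (norm_nonneg _) this 2
      nlinarith)
  have hP : ∀ i b, ‖(L (cls b)).univExtP i (w (iz b))‖ ≤ E := fun i b =>
    ((hPZ b i _).1).trans (hmonoC b)
  have hZ : ∀ i b, ‖(L (cls b)).univExtZ i (w (iz b))‖ ≤ E := fun i b =>
    ((hPZ b i _).2).trans (hmonoC b)
  have hnone : ∀ M : γ → Fin 3, ‖thetaPnone (β := β) (δ := δ) L cls M w‖ ≤ E ^ n := fun M =>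
    norm_prod_le_pow Finset.univ hE1 (fun b _ => hP (M b) b) (by simp [hn])
  have herase : ∀ (M : γ → Fin 3) (b : γ),
      ‖∏ b' ∈ Finset.univ.erase b, (L (cls b')).univExtP (M b') (w (iz b'))‖ ≤ E ^ n := fun M b =>
    norm_prod_le_pow _ hE1 (fun b' _ => hP (M b') b')
      ((Finset.card_erase_le).trans (by simp [hn]))
  have hEn0 : 0 ≤ E ^ n := pow_nonneg hE0 n
  have hsome : ∀ (M : γ → Fin 3) (e : δ),
      ‖thetaPsome (β := β) L cls κM M e w‖ ≤ (R + K) * E ^ (n + 1) := by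
    intro M e
    have hEn1 : E ^ n ≤ E ^ (n + 1) := pow_le_pow_right₀ hE1 (Nat.le_succ n)
    have hEn10 : 0 ≤ E ^ (n + 1) := pow_nonneg hE0 _
    have h1 : ‖w (is e) * thetaPnone (β := β) (δ := δ) L cls M w‖ ≤ R * E ^ (n + 1) := by
      rw [norm_mul]
      exact mul_le_mul (hcoord _) ((hnone M).trans hEn1) (norm_nonneg _) hR0
    have h2 : ‖∑ b, (κM e b : ℂ) * ((L (cls b)).univExtZ (M b) (w (iz b)) *
        ∏ b' ∈ Finset.univ.erase b, (L (cls b')).univExtP (M b') (w (iz b')))‖ ≤ K * E ^ (n + 1) := by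
      calc _ ≤ ∑ b, ‖(κM e b : ℂ) * ((L (cls b)).univExtZ (M b) (w (iz b)) *
              ∏ b' ∈ Finset.univ.erase b, (L (cls b')).univExtP (M b') (w (iz b')))‖ :=
            norm_sum_le _ _
        _ ≤ ∑ b, ‖(κM e b : ℂ)‖ * E ^ (n + 1) := by
            refine Finset.sum_le_sum fun b _ => ?_
            rw [norm_mul, norm_mul, pow_succ']
            refine mul_le_mul_of_nonneg_left ?_ (norm_nonneg _)
            exact mul_le_mul (hZ (M b) b) (herase M b) (norm_nonneg _) hE0
        _ = (∑ b, ‖(κM e b : ℂ)‖) * E ^ (n + 1) := (Finset.sum_mul _ _ _).symm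
        _ ≤ K * E ^ (n + 1) := by
            refine mul_le_mul_of_nonneg_right ?_ hEn10
            rw [hK]
            exact Finset.single_le_sum (f := fun e => ∑ b, ‖(κM e b : ℂ)‖)
              (fun e _ => Finset.sum_nonneg fun b _ => norm_nonneg _) (Finset.mem_univ e)
    calc ‖thetaPsome (β := β) L cls κM M e w‖
        ≤ ‖w (is e) * thetaPnone (β := β) (δ := δ) L cls M w‖ +
          ‖∑ b, (κM e b : ℂ) * ((L (cls b)).univExtZ (M b) (w (iz b)) *
            ∏ b' ∈ Finset.univ.erase b, (L (cls b')).univExtP (M b') (w (iz b')))‖ := norm_sub_le _ _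
      _ ≤ R * E ^ (n + 1) + K * E ^ (n + 1) := add_le_add h1 h2
      _ = (R + K) * E ^ (n + 1) := by ring
  have hthetaP : ∀ I, ‖thetaP (β := β) L cls κM I w‖ ≤ (1 + R + K) * E ^ (n + 1) := by
    rintro ⟨M, _ | e⟩
    · rw [thetaP_none]
      calc ‖thetaPnone L cls M w‖ ≤ E ^ n := hnone M
        _ ≤ E ^ (n + 1) := pow_le_pow_right₀ hE1 (Nat.le_succ n)
        _ = 1 * E ^ (n + 1) := (one_mul _).symm
        _ ≤ (1 + R + K) * E ^ (n + 1) := by gcongr; linarith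
    · rw [thetaP_some]
      calc ‖thetaPsome L cls κM M e w‖ ≤ (R + K) * E ^ (n + 1) := hsome M e
        _ ≤ (1 + R + K) * E ^ (n + 1) := by gcongr; linarith
  have hT : ∀ a, ‖thetaT (γ := γ) (δ := δ) a w‖ ≤ Real.exp R := by
    rintro (_ | j)
    · simpa using Real.one_le_exp hR0
    · rw [thetaT_some, Complex.norm_exp]
      exact Real.exp_le_exp.mpr ((Complex.re_le_norm _).trans (hcoord _))
  have hmain : ‖theta L cls κM J w‖ ≤ Real.exp R * ((1 + R + K) * E ^ (n + 1)) := by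
    rw [theta, norm_mul]
    exact mul_le_mul (hT J.1) (hthetaP J.2) (norm_nonneg _) (Real.exp_pos R).le
  refine hmain.trans ?_
  have hlin : 1 + R + K ≤ Real.exp (R + K) := by
    have := Real.add_one_le_exp (R + K); linarith
  have hEn : E ^ (n + 1) = Real.exp (C₀ * (n + 1) * (1 + R ^ 2)) := by
    rw [hE, ← Real.exp_nat_mul]; congr 1; push_cast; ring
  have hR2 : R ≤ 1 + R ^ 2 := by nlinarith [sq_nonneg (R - 1)]
  calc Real.exp R * ((1 + R + K) * E ^ (n + 1))
      ≤ Real.exp R * (Real.exp (R + K) * E ^ (n + 1)) := by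
        gcongr
    _ = Real.exp (R + (R + K) + C₀ * (n + 1) * (1 + R ^ 2)) := by
        rw [hEn, ← Real.exp_add, ← Real.exp_add]; ring_nf
    _ ≤ Real.exp ((C₀ * (n + 1) + K + 3) * (1 + ‖w‖ ^ 2)) := by
        rw [← hR]
        refine Real.exp_le_exp.mpr ?_
        nlinarith [mul_nonneg hK0 (sq_nonneg R), sq_nonneg R, mul_nonneg hC₀ (sq_nonneg R)]

/-! ### Analyticity -/

omit [DecidableEq γ] in
omit [DecidableEq 𝓙] in
/-- `w ↦ P_i(z'_b(w))` is analytic. [folklore] -/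
theorem analyticAt_univExtP_comp (i : Fin 3) (b : γ) (w : β ⊕ (γ ⊕ δ) → ℂ) :
    AnalyticAt ℂ (fun w : β ⊕ (γ ⊕ δ) → ℂ => (L (cls b)).univExtP i (w (iz b))) w :=
  analyticAt_comp_coord ((L (cls b)).differentiable_univExtP i) (iz b) w

omit [DecidableEq γ] in
omit [DecidableEq 𝓙] in
/-- `w ↦ Z_i(z'_b(w))` is analytic. [folklore] -/
theorem analyticAt_univExtZ_comp (i : Fin 3) (b : γ) (w : β ⊕ (γ ⊕ δ) → ℂ) :
    AnalyticAt ℂ (fun w : β ⊕ (γ ⊕ δ) → ℂ => (L (cls b)).univExtZ i (w (iz b))) w :=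
  analyticAt_comp_coord ((L (cls b)).differentiable_univExtZ i) (iz b) w

omit [DecidableEq γ] in
omit [DecidableEq 𝓙] in
/-- `Θ^P_{(M, none)}` is analytic. [folklore] -/
theorem analyticAt_thetaPnone (M : γ → Fin 3) (w : β ⊕ (γ ⊕ δ) → ℂ) :
    AnalyticAt ℂ (thetaPnone (β := β) (δ := δ) L cls M) w := by
  have : thetaPnone (β := β) (δ := δ) L cls M = fun w => ∏ b, (L (cls b)).univExtP (M b) (w (iz b)) :=
    rfl
  rw [this]
  exact Finset.univ.analyticAt_fun_prod fun b _ => analyticAt_univExtP_comp L cls (M b) b w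

omit [DecidableEq 𝓙] in
/-- `Θ^P_{(M, some e)}` is analytic. [folklore] -/
theorem analyticAt_thetaPsome (M : γ → Fin 3) (e : δ) (w : β ⊕ (γ ⊕ δ) → ℂ) :
    AnalyticAt ℂ (thetaPsome (β := β) L cls κM M e) w := by
  have : thetaPsome (β := β) L cls κM M e = fun w => w (is e) * thetaPnone L cls M w -
      ∑ b, (κM e b : ℂ) * ((L (cls b)).univExtZ (M b) (w (iz b)) *
        ∏ b' ∈ Finset.univ.erase b, (L (cls b')).univExtP (M b') (w (iz b'))) := rfl
  rw [this]
  refine ((analyticAt_coord (is e) w).mul (analyticAt_thetaPnone L cls M w)).sub ?_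
  refine Finset.analyticAt_fun_sum _ fun b _ => analyticAt_const.mul ?_
  exact (analyticAt_univExtZ_comp L cls (M b) b w).mul
    ((Finset.univ.erase b).analyticAt_fun_prod fun b' _ => analyticAt_univExtP_comp L cls (M b') b' w)

omit [DecidableEq 𝓙] in
/-- The theta functions of `P` are analytic. [folklore] -/
theorem analyticAt_thetaP (I : ThetaIdx γ δ) (w : β ⊕ (γ ⊕ δ) → ℂ) :
    AnalyticAt ℂ (thetaP (β := β) L cls κM I) w := by
  obtain ⟨M, _ | e⟩ := I
  · exact analyticAt_thetaPnone L cls M w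
  · exact analyticAt_thetaPsome L cls κM M e w

omit [DecidableEq 𝓙] in
/-- **The theta functions of `M` are analytic.** [folklore] -/
theorem analyticAt_theta (J : Option β × ThetaIdx γ δ) (w : β ⊕ (γ ⊕ δ) → ℂ) :
    AnalyticAt ℂ (theta L cls κM J) w :=
  (analyticAt_thetaT J.1 w).mul (analyticAt_thetaP L cls κM J.2 w)

omit [DecidableEq 𝓙] in
/-- The theta functions are analytic on the whole space. [folklore] -/
theorem analyticOnNhd_theta (J : Option β × ThetaIdx γ δ) :
    AnalyticOnNhd ℂ (theta L cls κM J) univ :=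
  fun w _ => analyticAt_theta L cls κM J w

omit [DecidableEq 𝓙] in
/-- **The forms `F_P = P(Θ)` are analytic.** [folklore] -/
theorem analyticAt_thetaEval (P : MvPolynomial (Option β × ThetaIdx γ δ) ℂ)
    (w : β ⊕ (γ ⊕ δ) → ℂ) : AnalyticAt ℂ (thetaEval L cls κM P) w := by
  unfold thetaEval
  induction P using MvPolynomial.induction_on with
  | C a => simpa using analyticAt_const
  | add p q hp hq =>
    simp only [map_add]
    exact hp.add hq
  | mul_X p J hp =>
    simp only [map_mul, MvPolynomial.eval_X]
    exact hp.mul (analyticAt_theta L cls κM J w)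

omit [DecidableEq 𝓙] in
/-- `F_P` is analytic on the whole space. [folklore] -/
theorem analyticOnNhd_thetaEval (P : MvPolynomial (Option β × ThetaIdx γ δ) ℂ) :
    AnalyticOnNhd ℂ (thetaEval L cls κM P) univ :=
  fun w _ => analyticAt_thetaEval L cls κM P w

omit [DecidableEq 𝓙] in
/-- `F_P` is `C^ω`. [folklore] -/
theorem contDiff_thetaEval (P : MvPolynomial (Option β × ThetaIdx γ δ) ℂ) :
    ContDiff ℂ ω (thetaEval L cls κM P) :=
  (analyticOnNhd_thetaEval L cls κM P).contDiff

omit [DecidableEq 𝓙] in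
/-- `F_P` is differentiable (entire). [folklore] -/
theorem differentiable_thetaEval (P : MvPolynomial (Option β × ThetaIdx γ δ) ℂ) :
    Differentiable ℂ (thetaEval L cls κM P) :=
  fun w => (analyticAt_thetaEval L cls κM P w).differentiableAt

omit [DecidableEq 𝓙] in
/-- `F_P` is continuous. [folklore] -/
theorem continuous_thetaEval (P : MvPolynomial (Option β × ThetaIdx γ δ) ℂ) :
    Continuous (thetaEval L cls κM P) :=
  (differentiable_thetaEval L cls κM P).continuous

end Std

end GaGmEFam

end Literature.NumberTheory.Transcendental

end
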